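import Literature.Analysis.FluidPDE.AxisymNoSwirlCoSignedFlux
import Literature.Analysis.FluidPDE.WholeSpaceIBPIntegrable
import Literature.Analysis.FluidPDE.PressurePoisson
import HarnessLib

/-!
# Axisymmetric flows without swirl: the impulse pairing `∫ (ω_θ/r) · (x_h · u) dx = 0` and the
# divergence form of the `η`-diffusion (steps of Gallay–Šverák 2015, Lemma 6.4)

Analysis/FluidPDE proof file (theorems only; no definitions, no named facts) on the discharge
path of the named fact `Literature.Analysis.FluidPDE.GallaySverak2015.ImpulseConservation`
(`AxisymNoSwirlScaleInvariantBounds.lean`; Th. Gallay, V. Šverák, *Remarks on the Cauchy problem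
for the axisymmetric Navier–Stokes equations*, Confluentes Math. 7 (2015) 67–92 =
arXiv:1510.01036, §6, Lemma 6.4: "for any non-negative solution of (4.1) in `L¹(Ω)` with finite
impulse, `∫_Ω r²ω_θ(r,z,t) dr dz = ∫_Ω r²ω₀ dr dz`", i.e. conservation of the impulse
`𝓘 = ∫_{ℝ³} r²η dx`, `η = ω_θ/r`).

The printed proof (arXiv p. 19) differentiates `t ↦ ∫ r²η(t)` using the `η`-equation
`∂ₜη + u·∇η = Δη + (2/r)∂ᵣη` ((2.9)/(4.1)) and observes that every term integrates to zero.  In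
the tree's smooth class (`IsTaoSolutionOn`, equation `IsClassicalNSSolutionOn.angVortQuot_eq`:
`Ω' + DΩ[u] = ν(ΔΩ + 2 radDerivQuot Ω)` without swirl, `Ω = angVortQuot u = ω_θ/r`) the two
mechanisms are:

* **transport.**  `∫ r² DΩ[u] = -∫ Ω D(r²)[u] = -2∫ Ω (x₀u₀ + x₁u₁)`, and this vanishes because
  `Ω · (x₀u₀ + x₁u₁) = u₀ω₁ − u₁ω₀ = (u × ω)₂` for a swirl-free axisymmetric field
  (`ω = Ω · (−x₁, x₀, 0)`, the tree's `curl_eq_hadamardQuotFst_smul_rotGen`), while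
  `(u × ω)₂ = ∂₂(|u|²/2) − (u·∇)u₂` integrates to zero for every divergence-free `H¹` field
  (Lamb-vector identity; no symmetry needed);
* **diffusion.**  `r²(ΔΩ + 2 radDerivQuot Ω) = div (r² ∇Ω)` pointwise (the operator
  `Δ + (2/r)∂ᵣ` is `r⁻² div r² ∇`), so that against any weight `g` the diffusion pairs by the
  whole-space divergence theorem, `∫ g r²(ΔΩ + 2∂ᵣΩ/r) = -∫ r²⟪∇g, ∇Ω⟫`, with no axis term.

This file proves these slice statements:

* `curl_apply_zero_eq_sub`, `lambTwo_eq` — `(curl v)₀ = ∂₁v₂ − ∂₂v₁` and the pointwise identity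
  `v₀ω₁ − v₁ω₀ = ⟪v, Dv e₂⟫ − Dv₂[v]`;
* `integral_inner_fderiv_apply_single_eq_zero` (`∫ ⟪v, ∂₂v⟫ = 0`),
  `integral_fderiv_coord_apply_self_eq_zero` (`∫ Dv₂[v] = 0` for `div v = 0`) and
  `integral_lambTwo_eq_zero` — **`∫ (v × curl v)₂ dx = 0`** for `v ∈ C¹` divergence free with
  `‖v‖², ‖Dv‖² ∈ L¹`;
* `angVortQuot_mul_horizontal_eq_lambTwo` — `Ω · (x₀u₀ + x₁u₁) = u₀ω₁ − u₁ω₀` for axisymmetric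
  swirl-free `u ∈ C³`;
* `IsTaoSolutionOn.integral_angVortQuot_mul_horizontal_eq_zero` — **along a Tao-class solution
  from an axisymmetric swirl-free datum, `∫ Ω(t) (x₀u₀ + x₁u₁)(t) dx = 0` for every
  `t ∈ [0, T]`** (the transport term of the impulse balance);
* `cylRadius_sq_mul_laplacian_add_eq_divergence` — **`r²(ΔS + 2 radDerivQuot S) = div (r²∇S)`**
  for every axisymmetric scalar `S ∈ C²` (the diffusion term in divergence form);
* `IsTaoSolutionOn.integral_weight_mul_angVortQuot_deriv_eq` — **the weighted slice identity**
  `∫ r²g Ω' = ∫ D(r²g)[v] Ω + ν∫ Ω div(r²∇g)` for every weight `g ∈ C²` with `r²g`, `xᵢg`,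
  `r²∂ᵢg`, `div(r²∇g) ∈ L²` (transport and diffusion integrated by parts, no axis term).

The time balance with the bounded weights `g_ε = (1 + ε|x|²)⁻²` and the limit `ε → 0` (monotone /
dominated convergence, using `IsTaoSolutionOn.lintegral_abs_angVortQuot_le_of_datum`, the sign
persistence `…angVortQuot_nonneg_of_datum` and `…integral_angVortQuot_mul_horizontal_eq_zero`)
that complete the discharge are left to the sequel.

## References

* Th. Gallay, V. Šverák, Confluentes Math. 7 (2015) 67–92, arXiv:1510.01036, §6 Lemma 6.4 and
  its proof (arXiv p. 19); §2 (2.9). [`GallaySverak2016`]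
* P. G. Saffman, *Vortex Dynamics* (1992), §3.2 (hydrodynamic impulse `½∫ x × ω`; the identity
  `u × ω = ∇(|u|²/2) − (u·∇)u`). [folklore background]
-/

noncomputable section

open MeasureTheory Set Function Filter InnerProductSpace
open _root_.Topology
open scoped NNReal ENNReal RealInnerProductSpace Laplacian

namespace Literature.Analysis.FluidPDE

/-- Local notation for physical space `ℝ³ = EuclideanSpace ℝ (Fin 3)`. -/
local notation "ℝ³" => EuclideanSpace ℝ (Fin 3)

/-! ### The Lamb-vector component `(v × ω)₂` -/

section Lamb

variable {v : ℝ³ → ℝ³}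

/-- `(curl v x)₀ = ∂₁v₂ − ∂₂v₁` (companion of `curl_apply_one_eq_sub`). [cite: GallaySverak2016, §2 (2.6)–(2.9) (arXiv p. 5)] -/
theorem curl_apply_zero_eq_sub (v : ℝ³ → ℝ³) (x : ℝ³) :
    curl v x 0 = fderiv ℝ v x (EuclideanSpace.single 1 1) 2 -
      fderiv ℝ v x (EuclideanSpace.single 2 1) 1 := by
  simp [FluidPDE.curl]

/-- Expansion of a vector of `ℝ³` in the standard basis (three-term form of the tree's
`eq_sum_smul_single`). [folklore] -/
private theorem eq_add_smul_single₃ (w : ℝ³) :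
    w = (w 0) • EuclideanSpace.single 0 (1 : ℝ) + (w 1) • EuclideanSpace.single 1 (1 : ℝ) +
      (w 2) • EuclideanSpace.single 2 (1 : ℝ) := by
  ext i
  fin_cases i <;> simp

/-- `(Dv(x)[v x])₂ = v₀∂₀v₂ + v₁∂₁v₂ + v₂∂₂v₂` (linearity of `Dv(x)`). [folklore] -/
private theorem fderiv_apply_self_coord_two (x : ℝ³) :
    fderiv ℝ v x (v x) 2 = v x 0 * fderiv ℝ v x (EuclideanSpace.single 0 1) 2 +
      v x 1 * fderiv ℝ v x (EuclideanSpace.single 1 1) 2 +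
      v x 2 * fderiv ℝ v x (EuclideanSpace.single 2 1) 2 := by
  conv_lhs => rw [eq_add_smul_single₃ (v x)]
  rw [map_add, map_add, map_smul, map_smul, map_smul]
  simp only [PiLp.add_apply, PiLp.smul_apply, smul_eq_mul]

/-- **The Lamb-vector identity, third component, pointwise**: for `v` differentiable at `x` and
`ω = curl v`, `v₀ω₁ − v₁ω₀ = ⟪v, Dv(x)e₂⟫ − Dv₂(x)[v]` (i.e. `(v × ω)₂ = ∂₂(|v|²/2) − (v·∇)v₂`).
[cite: GallaySverak2016, §6 proof of Lemma 6.4 (arXiv p. 19)] -/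
theorem lambTwo_eq {x : ℝ³} (hv : DifferentiableAt ℝ v x) :
    v x 0 * curl v x 1 - v x 1 * curl v x 0 =
      ⟪v x, fderiv ℝ v x (EuclideanSpace.single 2 1)⟫ - fderiv ℝ (fun y => v y 2) x (v x) := by
  rw [curl_apply_one_eq_sub, curl_apply_zero_eq_sub, fderiv_apply_coord_vec3 hv,
    fderiv_apply_self_coord_two x]
  simp only [PiLp.inner_apply, Fin.sum_univ_three, RCLike.inner_apply, conj_trivial]
  ring

/-- `∂ₕ‖v‖² = 2⟪v, ∂ₕv⟫` (chain rule; copy of the tree's `fderiv_norm_sq_apply_eq_two_mul_inner`,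
restated to keep the imports light). [folklore] -/
private theorem fderiv_norm_sq_apply' {y : ℝ³} (hv : DifferentiableAt ℝ v y) (h : ℝ³) :
    fderiv ℝ (fun z => ‖v z‖ ^ 2) y h = 2 * ⟪v y, fderiv ℝ v y h⟫ := by
  rw [(hv.hasFDerivAt.norm_sq).fderiv]
  simp only [FunLike.coe_smul, Pi.smul_apply, ContinuousLinearMap.comp_apply,
    innerSL_apply_apply, nsmul_eq_mul, Nat.cast_ofNat]

/-- `|⟪v, Dv h⟫| ≤ (‖v‖² + ‖Dv‖²)/2` for a unit vector `h` (AM–GM). [folklore] -/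
private theorem abs_inner_fderiv_apply_le (x h : ℝ³) (hh : ‖h‖ = 1) :
    |⟪v x, fderiv ℝ v x h⟫| ≤ (‖v x‖ ^ 2 + ‖fderiv ℝ v x‖ ^ 2) / 2 := by
  have h1 : |⟪v x, fderiv ℝ v x h⟫| ≤ ‖v x‖ * ‖fderiv ℝ v x h‖ := abs_real_inner_le_norm _ _
  have h2 : ‖fderiv ℝ v x h‖ ≤ ‖fderiv ℝ v x‖ := by
    calc ‖fderiv ℝ v x h‖ ≤ ‖fderiv ℝ v x‖ * ‖h‖ := (fderiv ℝ v x).le_opNorm h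
      _ = ‖fderiv ℝ v x‖ := by rw [hh, mul_one]
  nlinarith [norm_nonneg (v x), norm_nonneg (fderiv ℝ v x), norm_nonneg (fderiv ℝ v x h),
    sq_nonneg (‖v x‖ - ‖fderiv ℝ v x‖)]

/-- **`∫ ⟪v, ∂₂v⟫ dx = 0`** for `v ∈ C¹` with `‖v‖², ‖Dv‖² ∈ L¹`: the divergence theorem
(`integral_divergence_eq_zero_of_integrable`) for the field `‖v‖² e₂`, whose divergence is
`∂₂‖v‖² = 2⟪v, ∂₂v⟫`. [cite: GallaySverak2016, §6 proof of Lemma 6.4 (arXiv p. 19)] -/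
theorem integral_inner_fderiv_apply_single_eq_zero (hv : ContDiff ℝ 1 v)
    (h2 : Integrable (fun x => ‖v x‖ ^ 2)) (hD : Integrable (fun x => ‖fderiv ℝ v x‖ ^ 2)) :
    ∫ x, ⟪v x, fderiv ℝ v x (EuclideanSpace.single 2 1)⟫ = 0 := by
  set e : ℝ³ := EuclideanSpace.single 2 (1 : ℝ) with he
  have he1 : ‖e‖ = 1 := by simp [he]
  have hvd : Differentiable ℝ v := hv.differentiable one_ne_zero
  -- the field `w = ‖v‖² e₂`
  have hθ : ContDiff ℝ 1 fun y => ‖v y‖ ^ 2 := hv.norm_sq ℝ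
  have hw : ContDiff ℝ 1 fun y => (‖v y‖ ^ 2) • e := hθ.smul contDiff_const
  have hwint : Integrable fun y => (‖v y‖ ^ 2) • e := h2.smul_const e
  have hdivw : ∀ y, VectorCalculus.divergence (fun z => (‖v z‖ ^ 2) • e) y =
      2 * ⟪v y, fderiv ℝ v y e⟫ := by
    intro y
    rw [divergence_smul_apply (hθ.differentiable one_ne_zero y) (differentiableAt_const e)]
    have hc : VectorCalculus.divergence (fun _ : ℝ³ => e) y = 0 := by
      simp [VectorCalculus.divergence]
    rw [hc, mul_zero, zero_add, real_inner_comm, gradient, InnerProductSpace.toDual_symm_apply,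
      fderiv_norm_sq_apply' (hvd y)]
  have hprod : Integrable fun y => ⟪v y, fderiv ℝ v y e⟫ := by
    refine ((h2.add hD).div_const 2).mono' ((hv.continuous.inner
      ((hv.continuous_fderiv one_ne_zero).clm_apply continuous_const)).aestronglyMeasurable)
      (Eventually.of_forall fun y => ?_)
    rw [Real.norm_eq_abs]
    exact abs_inner_fderiv_apply_le y e he1
  have hdivint : Integrable fun y => VectorCalculus.divergence (fun z => (‖v z‖ ^ 2) • e) y := by
    simp_rw [hdivw]
    exact hprod.const_mul 2
  have h0 := integral_divergence_eq_zero_of_integrable hw hwint hdivint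
  simp_rw [hdivw, integral_const_mul] at h0
  linarith

/-- **`∫ Dv₂[v] dx = 0`** for a divergence-free `v ∈ C¹` with `‖v‖², ‖Dv‖² ∈ L¹`
(`∫ v₂ div v + ∫ ⟪v, ∇v₂⟫ = 0`, `integral_mul_divergence_add_eq_zero_of_integrable`).
[cite: GallaySverak2016, §6 proof of Lemma 6.4 (arXiv p. 19)] -/
theorem integral_fderiv_coord_apply_self_eq_zero (hv : ContDiff ℝ 1 v)
    (hdiv : VectorCalculus.IsDivFree v)
    (h2 : Integrable (fun x => ‖v x‖ ^ 2)) (hD : Integrable (fun x => ‖fderiv ℝ v x‖ ^ 2)) :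
    ∫ x, fderiv ℝ (fun y => v y 2) x (v x) = 0 := by
  have hvd : Differentiable ℝ v := hv.differentiable one_ne_zero
  have hθ : ContDiff ℝ 1 fun y => v y 2 := contDiff_apply_coord_vec3 hv 2
  have hgrad : ∀ y, ⟪v y, gradient (fun z => v z 2) y⟫ = fderiv ℝ (fun z => v z 2) y (v y) := by
    intro y
    rw [real_inner_comm, gradient, InnerProductSpace.toDual_symm_apply]
  -- integrability of the three pairings
  have hint : Integrable fun y => v y 2 • v y := by
    refine h2.mono' ((hθ.continuous.smul hv.continuous).aestronglyMeasurable)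
      (Eventually.of_forall fun y => ?_)
    rw [norm_smul, pow_two]
    exact mul_le_mul_of_nonneg_right ((Real.norm_eq_abs _).symm ▸
      (Real.norm_eq_abs (v y 2)).symm.le.trans (PiLp.norm_apply_le (v y) 2)) (norm_nonneg _)
  have h₁ : Integrable fun y => v y 2 * VectorCalculus.divergence v y := by
    simp only [hdiv _, mul_zero]
    exact integrable_zero _ _ _
  have h₂ : Integrable fun y => ⟪v y, gradient (fun z => v z 2) y⟫ := by
    simp_rw [hgrad]
    refine ((h2.add hD).div_const 2).mono'
      (((hθ.continuous_fderiv one_ne_zero).clm_apply hv.continuous).aestronglyMeasurable)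
      (Eventually.of_forall fun y => ?_)
    rw [fderiv_apply_coord_vec3 (hvd y), Real.norm_eq_abs]
    show |fderiv ℝ v y (v y) 2| ≤ (‖v y‖ ^ 2 + ‖fderiv ℝ v y‖ ^ 2) / 2
    have h3 : |fderiv ℝ v y (v y) 2| ≤ ‖fderiv ℝ v y (v y)‖ :=
      (Real.norm_eq_abs _).symm.le.trans (PiLp.norm_apply_le _ 2)
    have h4 : ‖fderiv ℝ v y (v y)‖ ≤ ‖fderiv ℝ v y‖ * ‖v y‖ := (fderiv ℝ v y).le_opNorm _
    nlinarith [norm_nonneg (v y), norm_nonneg (fderiv ℝ v y),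
      sq_nonneg (‖v y‖ - ‖fderiv ℝ v y‖)]
  have h := integral_mul_divergence_add_eq_zero_of_integrable hθ hv hint h₁ h₂
  simp only [hdiv _, mul_zero, integral_zero, zero_add] at h
  simp_rw [hgrad] at h
  exact h

/-- **`∫ (v × curl v)₂ dx = 0`**: for `v ∈ C¹(ℝ³)` divergence free with `‖v‖², ‖Dv‖² ∈ L¹`,
`∫ (v₀ω₁ − v₁ω₀) dx = 0` (`ω = curl v`) — the `e₂`-component of `∫ v × ω = 0`, from
`(v × ω)₂ = ∂₂(|v|²/2) − (v·∇)v₂` and the two previous lemmas. No symmetry is assumed.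
[cite: GallaySverak2016, §6 proof of Lemma 6.4 (arXiv p. 19)] -/
theorem integral_lambTwo_eq_zero (hv : ContDiff ℝ 1 v) (hdiv : VectorCalculus.IsDivFree v)
    (h2 : Integrable (fun x => ‖v x‖ ^ 2)) (hD : Integrable (fun x => ‖fderiv ℝ v x‖ ^ 2)) :
    ∫ x, (v x 0 * curl v x 1 - v x 1 * curl v x 0) = 0 := by
  have hvd : Differentiable ℝ v := hv.differentiable one_ne_zero
  have ha := integral_inner_fderiv_apply_single_eq_zero hv h2 hD
  have hb := integral_fderiv_coord_apply_self_eq_zero hv hdiv h2 hD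
  -- integrability of the two summands (needed for `integral_sub`)
  have hθ : ContDiff ℝ 1 fun y => v y 2 := contDiff_apply_coord_vec3 hv 2
  have ia : Integrable fun y => ⟪v y, fderiv ℝ v y (EuclideanSpace.single 2 1)⟫ := by
    refine ((h2.add hD).div_const 2).mono' ((hv.continuous.inner
      ((hv.continuous_fderiv one_ne_zero).clm_apply continuous_const)).aestronglyMeasurable)
      (Eventually.of_forall fun y => ?_)
    rw [Real.norm_eq_abs]
    exact abs_inner_fderiv_apply_le y _ (by simp)
  have ib : Integrable fun y => fderiv ℝ (fun z => v z 2) y (v y) := by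
    refine ((h2.add hD).div_const 2).mono'
      (((hθ.continuous_fderiv one_ne_zero).clm_apply hv.continuous).aestronglyMeasurable)
      (Eventually.of_forall fun y => ?_)
    rw [fderiv_apply_coord_vec3 (hvd y), Real.norm_eq_abs]
    show |fderiv ℝ v y (v y) 2| ≤ (‖v y‖ ^ 2 + ‖fderiv ℝ v y‖ ^ 2) / 2
    have h3 : |fderiv ℝ v y (v y) 2| ≤ ‖fderiv ℝ v y (v y)‖ :=
      (Real.norm_eq_abs _).symm.le.trans (PiLp.norm_apply_le _ 2)
    have h4 : ‖fderiv ℝ v y (v y)‖ ≤ ‖fderiv ℝ v y‖ * ‖v y‖ := (fderiv ℝ v y).le_opNorm _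
    nlinarith [norm_nonneg (v y), norm_nonneg (fderiv ℝ v y),
      sq_nonneg (‖v y‖ - ‖fderiv ℝ v y‖)]
  calc ∫ x, (v x 0 * curl v x 1 - v x 1 * curl v x 0)
      = ∫ x, (⟪v x, fderiv ℝ v x (EuclideanSpace.single 2 1)⟫ -
          fderiv ℝ (fun y => v y 2) x (v x)) :=
        integral_congr_ae (Eventually.of_forall fun x => lambTwo_eq (hvd x))
    _ = 0 := by rw [integral_sub ia ib, ha, hb, sub_zero]

end Lamb

/-! ### Axisymmetric swirl-free fields: `Ω · (x_h · u) = (u × ω)₂` -/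

section NoSwirl

variable {u : ℝ³ → ℝ³}

/-- For an axisymmetric swirl-free `u ∈ C³` with `Ω = angVortQuot u = ω_θ/r`:
`Ω(x) · (x₀u₀ + x₁u₁) = u₀ω₁ − u₁ω₀` everywhere (`ω = curl u = Ω · (−x₁, x₀, 0)`).
[cite: GallaySverak2016, §2 (2.9) and §6 proof of Lemma 6.4 (arXiv pp. 5, 19)] -/
theorem angVortQuot_mul_horizontal_eq_lambTwo (hax : IsAxisymmetric u) (hsw : HasNoSwirl u)
    (hu : ContDiff ℝ 3 u) (x : ℝ³) :
    angVortQuot u x * (x 0 * u x 0 + x 1 * u x 1) = u x 0 * curl u x 1 - u x 1 * curl u x 0 := by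
  have hω : curl u x = angVortQuot u x • rotGen x := by
    rw [angVortQuot_eq_hadamardQuotFst_curl hax hsw hu]
    exact curl_eq_hadamardQuotFst_smul_rotGen hax hsw (hu.of_le (by norm_num)) x
  have h0 : curl u x 0 = angVortQuot u x * (-x 1) := by
    rw [hω]; simp
  have h1 : curl u x 1 = angVortQuot u x * x 0 := by
    rw [hω]; simp
  rw [h0, h1]
  ring

variable {T ν : ℝ} {u₀ : ℝ³ → ℝ³} {v : ℝ → ℝ³ → ℝ³} {q : ℝ → ℝ³ → ℝ}

/-- **The transport term of the impulse balance vanishes.**  Along a Tao-class solution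
(`IsTaoSolutionOn T ν u₀ v q`, `0 < ν`, `0 < T`) from an axisymmetric swirl-free datum, for every
`t ∈ [0, T]`: `∫ Ω(t, x) (x₀v₀ + x₁v₁)(t, x) dx = 0`, `Ω = angVortQuot (v t)` — i.e.
`∫ η D(r²)[u] dx = 2∫ ω_θ u_r dx = 0`, the reason the drift `u·∇η` does not move the impulse
`∫ r²η`. [cite: GallaySverak2016, §6 proof of Lemma 6.4 (arXiv p. 19)] -/
theorem IsTaoSolutionOn.integral_angVortQuot_mul_horizontal_eq_zero (h : IsTaoSolutionOn T ν u₀ v q)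
    (hT : 0 < T) (hν : 0 < ν) (h0 : IsAxisymmetric u₀) (h0' : HasNoSwirl u₀) {t : ℝ}
    (ht : t ∈ Icc 0 T) :
    ∫ x, angVortQuot (v t) x * (x 0 * v t x 0 + x 1 * v t x 1) = 0 := by
  have hvs := h.classical.contDiff_velocity ht
  have hv3 : ContDiff ℝ 3 (v t) := hvs.of_le (by norm_cast)
  have hv1 : ContDiff ℝ 1 (v t) := hvs.of_le (by norm_cast)
  have hax : IsAxisymmetric (v t) := h.isAxisymmetric hν hT h0 t ht
  have hsw : HasNoSwirl (v t) := h.hasNoSwirl hν hT h0 h0' t ht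
  calc ∫ x, angVortQuot (v t) x * (x 0 * v t x 0 + x 1 * v t x 1)
      = ∫ x, (v t x 0 * curl (v t) x 1 - v t x 1 * curl (v t) x 0) :=
        integral_congr_ae (Eventually.of_forall fun x =>
          angVortQuot_mul_horizontal_eq_lambTwo hax hsw hv3 x)
    _ = 0 := integral_lambTwo_eq_zero hv1 (h.classical.divFree t ht) (h.integrable_norm_sq ht)
        (h.integrable_norm_fderiv_sq ht)

end NoSwirl

/-! ### The diffusion `Δ + (2/r)∂ᵣ` in divergence form -/

section Diffusion

variable {S : ℝ³ → ℝ}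

/-- The derivative of `y ↦ r(y)²` applied to a vector: `D(r²)(x)[w] = 2(x₀w₀ + x₁w₁)`. [folklore] -/
private theorem fderiv_cylRadius_sq_apply (x w : ℝ³) :
    fderiv ℝ (fun y : ℝ³ => cylRadius y ^ 2) x w = 2 * (x 0 * w 0 + x 1 * w 1) := by
  rw [(hasFDerivAt_cylRadius_sq x).fderiv]
  simp only [_root_.add_apply, _root_.smul_apply, smul_eq_mul]
  show 2 * x 0 * w 0 + 2 * x 1 * w 1 = _
  ring

/-- **`r²(ΔS + 2 radDerivQuot S) = div (r² ∇S)` pointwise**, for an axisymmetric scalar `S ∈ C²`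
(`radDerivQuot S = (∂ᵣS)/r` smoothly across the axis): `div (r²∇S) = r²ΔS + ⟪∇S, ∇r²⟫` and
`⟪∇S, ∇r²⟫ = 2 DS[x_h] = 2r² radDerivQuot S` (`fderiv_apply_horizontal_eq`).  This writes the
`η`-diffusion `Δη + (2/r)∂ᵣη` of (2.9) as `r⁻² div (r²∇η)`. [cite: GallaySverak2016, §2 (2.9) (arXiv p. 5)] -/
theorem cylRadius_sq_mul_laplacian_add_eq_divergence (hS : ContDiff ℝ 2 S)
    (hax : IsAxisymmetricScalar S) (x : ℝ³) :
    cylRadius x ^ 2 * ((Δ S) x + 2 * radDerivQuot S x) =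
      VectorCalculus.divergence (fun y => (cylRadius y ^ 2) • gradient S y) x := by
  have hθ : Differentiable ℝ fun y : ℝ³ => cylRadius y ^ 2 := fun y =>
    (hasFDerivAt_cylRadius_sq y).differentiableAt
  have hgrad : ContDiff ℝ 1 (gradient S) := by
    have h1 : ContDiff ℝ 1 (fderiv ℝ S) := hS.fderiv_right (m := 1) le_rfl
    exact (InnerProductSpace.toDual ℝ ℝ³).symm.contDiff.comp h1
  rw [divergence_smul_apply (hθ x) (hgrad.differentiable one_ne_zero x), divergence_gradient hS x]
  -- the cross term `⟪∇S, ∇r²⟫ = D(r²)[∇S] = 2(x₀ ∂₀S + x₁ ∂₁S) = 2 r² radDerivQuot S`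
  have hcross : ⟪gradient S x, gradient (fun y : ℝ³ => cylRadius y ^ 2) x⟫ =
      2 * (cylRadius x ^ 2 * radDerivQuot S x) := by
    rw [real_inner_comm, gradient, InnerProductSpace.toDual_symm_apply, fderiv_cylRadius_sq_apply,
      ← fderiv_apply_horizontal_eq hS hax x, map_add, map_smul, map_smul, smul_eq_mul, smul_eq_mul]
    have ecoord : ∀ i : Fin 3, gradient S x i = fderiv ℝ S x (EuclideanSpace.single i 1) := by
      intro i
      have h1 : fderiv ℝ S x (EuclideanSpace.single i 1) =
          ⟪gradient S x, EuclideanSpace.single i (1 : ℝ)⟫ := by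
        rw [gradient, InnerProductSpace.toDual_symm_apply]
      rw [h1, EuclideanSpace.inner_single_right]
      simp
    rw [← ecoord 0, ← ecoord 1]
  linear_combination -hcross

end Diffusion

/-! ### The weighted slice identity in Tao's class -/

section Slice

/-- `‖w‖ ≤ |w₀| + |w₁| + |w₂|` on `ℝ³`. [folklore] -/
private theorem norm_le_abs_add (w : ℝ³) : ‖w‖ ≤ |w 0| + |w 1| + |w 2| := by
  have h : ‖w‖ ^ 2 = w 0 ^ 2 + w 1 ^ 2 + w 2 ^ 2 := by
    rw [EuclideanSpace.norm_sq_eq, Fin.sum_univ_three]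
    simp only [Real.norm_eq_abs, sq_abs]
  have hs : ‖w‖ ^ 2 ≤ (|w 0| + |w 1| + |w 2|) ^ 2 := by
    rw [h]
    nlinarith [abs_nonneg (w 0), abs_nonneg (w 1), abs_nonneg (w 2), sq_abs (w 0), sq_abs (w 1),
      sq_abs (w 2)]
  exact (pow_le_pow_iff_left₀ (norm_nonneg w) (by positivity) two_ne_zero).1 hs

/-- The coordinates of the gradient are the partial derivatives. [folklore] -/
private theorem gradient_apply_eq_fderiv_single₃ {S : ℝ³ → ℝ} (x : ℝ³) (i : Fin 3) :
    gradient S x i = fderiv ℝ S x (EuclideanSpace.single i 1) := by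
  have h1 : fderiv ℝ S x (EuclideanSpace.single i 1) = ⟪gradient S x, EuclideanSpace.single i (1 : ℝ)⟫ := by
    rw [gradient, InnerProductSpace.toDual_symm_apply]
  rw [h1, EuclideanSpace.inner_single_right]
  simp

/-- The real inner product on `ℝ³` in coordinates. [folklore] -/
private theorem inner_eq_sum₃ (a b : ℝ³) : ⟪a, b⟫ = a 0 * b 0 + a 1 * b 1 + a 2 * b 2 := by
  simp only [PiLp.inner_apply, Fin.sum_univ_three, RCLike.inner_apply, conj_trivial]
  ring

/-- Without swirl the angular velocity quotient `u^θ/r` vanishes identically (copy of the private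
lemma of `AxisymNoSwirlCoSignedFlux`). [folklore] -/
private theorem angVelQuot_eq_zero_of_hasNoSwirl' {u : ℝ³ → ℝ³} (hsw : HasNoSwirl u) :
    angVelQuot u = 0 := by
  have h0 : swirl u = fun _ => 0 := funext fun x => hsw x
  funext x
  simp only [angVelQuot, h0, Pi.zero_apply]
  have h1 : radDerivQuot (fun _ : ℝ³ => (0 : ℝ)) = fun _ => 0 := by
    funext y
    simp [radDerivQuot, hadamardQuotFst]
  simp [radQuot, h1]

/-- Product rule for the weight `φ = r² g`: `Dφ(x)[w] = 2(x₀w₀ + x₁w₁) g(x) + r² Dg(x)[w]`. [folklore] -/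
private theorem fderiv_cylRadius_sq_mul_apply {g : ℝ³ → ℝ} (hg : Differentiable ℝ g) (x w : ℝ³) :
    fderiv ℝ (fun y => cylRadius y ^ 2 * g y) x w =
      2 * (x 0 * w 0 + x 1 * w 1) * g x + cylRadius x ^ 2 * fderiv ℝ g x w := by
  have hθ : DifferentiableAt ℝ (fun y : ℝ³ => cylRadius y ^ 2) x :=
    (hasFDerivAt_cylRadius_sq x).differentiableAt
  rw [fderiv_fun_mul hθ (hg x)]
  simp only [_root_.add_apply, _root_.smul_apply, smul_eq_mul, fderiv_cylRadius_sq_apply]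
  ring

variable {T ν : ℝ} {u₀ : ℝ³ → ℝ³} {v : ℝ → ℝ³ → ℝ³} {q : ℝ → ℝ³ → ℝ}

/-- **The weighted slice identity** (the computation of Gallay–Šverák 2015, Lemma 6.4 against a
bounded weight).  Along a Tao-class solution `(v, q)` on `[0, T]` (`0 < ν`, `0 < T`) from an
axisymmetric swirl-free datum, let `Ω = angVortQuot (v t)`, `Ω' = angVortQuot (∂ₜv t)`, and let
`g ∈ C²(ℝ³)` be a weight with `r²g`, `xᵢ g`, `r²∇g`, `div (r²∇g) ∈ L²`.  Then for `t ∈ [0, T]`: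
`∫ r² g Ω' dx = ∫ D(r²g)[v] Ω dx + ν ∫ Ω div(r²∇g) dx` — transport integrated by parts
(`div v = 0`) and the diffusion `r²(ΔΩ + 2∂ᵣΩ/r) = div (r²∇Ω)` integrated by parts twice
(no axis term).  With `g ↑ 1` this is the identity behind `d/dt ∫ r²η = 0`.
[cite: GallaySverak2016, §6 proof of Lemma 6.4 (arXiv p. 19)] -/
theorem IsTaoSolutionOn.integral_weight_mul_angVortQuot_deriv_eq (h : IsTaoSolutionOn T ν u₀ v q)
    (hT : 0 < T) (hν : 0 < ν) (h0 : IsAxisymmetric u₀) (h0' : HasNoSwirl u₀)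
    {g : ℝ³ → ℝ} (hg : ContDiff ℝ 2 g)
    (hgL2 : MemLp (fun x => cylRadius x ^ 2 * g x) 2 volume)
    (hxg : ∀ i : Fin 3, MemLp (fun x => x i * g x) 2 volume)
    (hDg : ∀ i : Fin 3, MemLp (fun x => cylRadius x ^ 2 * fderiv ℝ g x (EuclideanSpace.single i 1))
      2 volume)
    (hdivg : MemLp (fun x => VectorCalculus.divergence
      (fun y => (cylRadius y ^ 2) • gradient g y) x) 2 volume)
    {t : ℝ} (ht : t ∈ Icc 0 T) :
    ∫ x, cylRadius x ^ 2 * g x * angVortQuot (timeDerivWithin (Icc 0 T) v t) x =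
      (∫ x, fderiv ℝ (fun y => cylRadius y ^ 2 * g y) x (v t x) * angVortQuot (v t) x) +
      ν * ∫ x, angVortQuot (v t) x *
        VectorCalculus.divergence (fun y => (cylRadius y ^ 2) • gradient g y) x := by
  have hU : UniqueDiffOn ℝ (Icc 0 T) := uniqueDiffOn_Icc hT
  have hcl := Icc_subset_closure_interior_Icc' hT
  have hax : ∀ s ∈ Icc 0 T, IsAxisymmetric (v s) := h.isAxisymmetric hν hT h0
  have hsw : HasNoSwirl (v t) := h.hasNoSwirl hν hT h0 h0' t ht
  have hvs := h.classical.contDiff_velocity ht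
  have hv1 : ContDiff ℝ 1 (v t) := hvs.of_le (by norm_cast)
  have hv3 : ContDiff ℝ 3 (v t) := hvs.of_le (by norm_cast)
  have hvd : Differentiable ℝ (v t) := hv1.differentiable one_ne_zero
  set Ω : ℝ³ → ℝ := angVortQuot (v t) with hΩdef
  set Ω' : ℝ³ → ℝ := angVortQuot (timeDerivWithin (Icc 0 T) v t) with hΩ'def
  have hΩ2 : ContDiff ℝ 2 Ω := contDiff_angVortQuot (n := 2) (by exact_mod_cast hvs.of_le (by norm_cast))
  have hΩ1 : ContDiff ℝ 1 Ω := hΩ2.of_le (by norm_num)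
  have hΩd : Differentiable ℝ Ω := hΩ1.differentiable one_ne_zero
  have hΩax : IsAxisymmetricScalar Ω := (hax t ht).isAxisymmetricScalar_angVortQuot hv3
  have hΩ'c : Continuous Ω' :=
    (contDiff_angVortQuot (n := 0) (by
      exact_mod_cast (h.classical.smooth_velocity.contDiff_timeDerivWithin_slice hU ht).of_le
        (by norm_cast))).continuous
  obtain ⟨m0, m1, m2, mq⟩ := h.memLp_angVortQuot_data hax ht
  obtain ⟨C', hC'⟩ := h.exists_lintegral_sq_quot_le hT hax
  have mΩ' : MemLp Ω' 2 volume :=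
    memLp_two_of_lintegral_sq_le_coe hΩ'c (hC' t ht).2.1
  obtain ⟨B, -, hB⟩ := h.exists_bound_velocity
  obtain ⟨B', -, hB'⟩ := h.exists_bound_fderiv_velocity
  -- the weight
  set φ : ℝ³ → ℝ := fun x => cylRadius x ^ 2 * g x with hφdef
  have hr2 : ContDiff ℝ 1 fun y : ℝ³ => cylRadius y ^ 2 := by
    have : (fun y : ℝ³ => cylRadius y ^ 2) = fun y => y 0 ^ 2 + y 1 ^ 2 := funext cylRadius_sq
    rw [this]; fun_prop
  have hg1 : ContDiff ℝ 1 g := hg.of_le (by norm_num)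
  have hgd : Differentiable ℝ g := hg1.differentiable one_ne_zero
  have hφ1 : ContDiff ℝ 1 φ := hr2.mul hg1
  -- the equation without swirl
  have heq : ∀ x, Ω' x = ν * ((Δ Ω) x + 2 * radDerivQuot Ω x) - fderiv ℝ Ω x (v t x) := by
    intro x
    have e := h.classical.angVortQuot_eq hU hcl hax ht x
    rw [angVelQuot_eq_zero_of_hasNoSwirl' hsw] at e
    simp only [Pi.zero_apply] at e
    rw [hΩ'def, hΩdef]
    linarith
  -- Laplacian in `L²`
  have hΔ : MemLp (fun x => (Δ Ω) x) 2 volume := by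
    have e : (fun x => (Δ Ω) x) = fun x =>
        fderiv ℝ (fun y => fderiv ℝ Ω y (EuclideanSpace.single 0 1)) x (EuclideanSpace.single 0 1) +
        fderiv ℝ (fun y => fderiv ℝ Ω y (EuclideanSpace.single 1 1)) x (EuclideanSpace.single 1 1) +
        fderiv ℝ (fun y => fderiv ℝ Ω y (EuclideanSpace.single 2 1)) x (EuclideanSpace.single 2 1) := by
      funext x
      rw [laplacian_eq_sum_fderiv_fderiv (EuclideanSpace.basisFun (Fin 3) ℝ) hΩ2 x]
      simp only [EuclideanSpace.basisFun_apply, Fin.sum_univ_three]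
    rw [e]
    exact ((m2 0).add (m2 1)).add (m2 2)
  -- (T) transport: `∫ φ DΩ[v] = -∫ Dφ[v] Ω`
  have hT' : ∫ x, φ x * fderiv ℝ Ω x (v t x) = -∫ x, fderiv ℝ φ x (v t x) * Ω x := by
    refine integral_mul_fderiv_apply_eq_neg_of_isDivFree' hφ1 hΩ1 hv1 (h.classical.divFree t ht)
      (hB t ht) (hB' t ht) (hgL2.integrable_mul m0) (fun i => ?_) (fun i => hgL2.integrable_mul (m1 i))
    -- `∂ᵢφ · Ω ∈ L¹`: `∂ᵢφ = 2 xᵢ g (i = 0, 1) + r² ∂ᵢg`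
    have e : (fun x => fderiv ℝ φ x (EuclideanSpace.single i 1) * Ω x) = fun x =>
        (2 * (x 0 * (EuclideanSpace.single i (1 : ℝ) : ℝ³) 0 +
          x 1 * (EuclideanSpace.single i (1 : ℝ) : ℝ³) 1) * g x) * Ω x +
        (cylRadius x ^ 2 * fderiv ℝ g x (EuclideanSpace.single i 1)) * Ω x := by
      funext x
      rw [hφdef, fderiv_cylRadius_sq_mul_apply hgd]
      ring
    rw [e]
    refine Integrable.add ?_ ((hDg i).integrable_mul m0)
    have hxi : MemLp (fun x : ℝ³ => 2 * (x 0 * (EuclideanSpace.single i (1 : ℝ) : ℝ³) 0 +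
        x 1 * (EuclideanSpace.single i (1 : ℝ) : ℝ³) 1) * g x) 2 volume := by
      fin_cases i
      · refine ((hxg 0).const_mul 2).ae_eq (Eventually.of_forall fun x => ?_)
        simp; ring
      · refine ((hxg 1).const_mul 2).ae_eq (Eventually.of_forall fun x => ?_)
        simp; ring
      · have e0 : (fun x : ℝ³ => 2 * (x 0 * (EuclideanSpace.single (2 : Fin 3) (1 : ℝ) : ℝ³) 0 +
            x 1 * (EuclideanSpace.single (2 : Fin 3) (1 : ℝ) : ℝ³) 1) * g x) = fun _ => 0 := by
          funext x; simp
        simp only [Fin.reduceFinMk]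
        rw [e0]
        exact MemLp.zero'
    exact hxi.integrable_mul m0
  -- (D) diffusion: `∫ φ (ΔΩ + 2 rdq Ω) = ∫ Ω div(r² ∇g)`
  have hdivW : ∀ x, VectorCalculus.divergence (fun y => (cylRadius y ^ 2) • gradient Ω y) x =
      cylRadius x ^ 2 * ((Δ Ω) x + 2 * radDerivQuot Ω x) := fun x =>
    (cylRadius_sq_mul_laplacian_add_eq_divergence hΩ2 hΩax x).symm
  have hgradΩ : ContDiff ℝ 1 (gradient Ω) :=
    (InnerProductSpace.toDual ℝ ℝ³).symm.contDiff.comp (hΩ2.fderiv_right (m := 1) le_rfl)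
  have hgradg : ContDiff ℝ 1 (gradient g) :=
    (InnerProductSpace.toDual ℝ ℝ³).symm.contDiff.comp (hg.fderiv_right (m := 1) le_rfl)
  have hW : ContDiff ℝ 1 fun y => (cylRadius y ^ 2) • gradient Ω y := hr2.smul hgradΩ
  have hV : ContDiff ℝ 1 fun y => (cylRadius y ^ 2) • gradient g y := hr2.smul hgradg
  -- `⟪r²∇Ω, ∇g⟫ = Σᵢ ∂ᵢΩ · (r² ∂ᵢg)` and its integrability
  have hpair : ∀ x, ⟪(cylRadius x ^ 2) • gradient Ω x, gradient g x⟫ =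
      fderiv ℝ Ω x (EuclideanSpace.single 0 1) * (cylRadius x ^ 2 * fderiv ℝ g x (EuclideanSpace.single 0 1)) +
      fderiv ℝ Ω x (EuclideanSpace.single 1 1) * (cylRadius x ^ 2 * fderiv ℝ g x (EuclideanSpace.single 1 1)) +
      fderiv ℝ Ω x (EuclideanSpace.single 2 1) * (cylRadius x ^ 2 * fderiv ℝ g x (EuclideanSpace.single 2 1)) := by
    intro x
    rw [real_inner_smul_left, inner_eq_sum₃]
    simp only [gradient_apply_eq_fderiv_single₃]
    ring
  have hpair' : ∀ x, ⟪(cylRadius x ^ 2) • gradient g x, gradient Ω x⟫ =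
      ⟪(cylRadius x ^ 2) • gradient Ω x, gradient g x⟫ := by
    intro x
    rw [real_inner_smul_left, real_inner_smul_left, real_inner_comm]
  have ipair : Integrable fun x => ⟪(cylRadius x ^ 2) • gradient Ω x, gradient g x⟫ := by
    simp_rw [hpair]
    exact (((m1 0).integrable_mul (hDg 0)).add ((m1 1).integrable_mul (hDg 1))).add
      ((m1 2).integrable_mul (hDg 2))
  -- IBP1: `∫ g div(r²∇Ω) + ∫ ⟪r²∇Ω, ∇g⟫ = 0`
  have ibp1 := integral_mul_divergence_add_eq_zero_of_integrable (θ := g)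
    (u := fun y => (cylRadius y ^ 2) • gradient Ω y) hg1 hW ?_ ?_ ipair
  rotate_left
  · -- `g • (r²∇Ω) ∈ L¹`
    have hb : Integrable fun x => |cylRadius x ^ 2 * g x| *
        (|fderiv ℝ Ω x (EuclideanSpace.single 0 1)| + |fderiv ℝ Ω x (EuclideanSpace.single 1 1)| +
          |fderiv ℝ Ω x (EuclideanSpace.single 2 1)|) := by
      have := ((hgL2.norm.integrable_mul (m1 0).norm).add (hgL2.norm.integrable_mul (m1 1).norm)).add
        (hgL2.norm.integrable_mul (m1 2).norm)
      refine this.congr (Eventually.of_forall fun x => ?_)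
      simp only [Pi.add_apply, Pi.mul_apply, Real.norm_eq_abs]
      ring
    refine hb.mono' ((hg1.continuous.smul hW.continuous).aestronglyMeasurable)
      (Eventually.of_forall fun x => ?_)
    rw [norm_smul, norm_smul, Real.norm_eq_abs, Real.norm_eq_abs, ← mul_assoc, ← abs_mul, mul_comm (g x)]
    gcongr
    refine (norm_le_abs_add _).trans (le_of_eq ?_)
    simp only [gradient_apply_eq_fderiv_single₃]
  · -- `g div(r²∇Ω) ∈ L¹`
    have e : (fun x => g x * VectorCalculus.divergence (fun y => (cylRadius y ^ 2) • gradient Ω y) x) =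
        fun x => (cylRadius x ^ 2 * g x) * ((Δ Ω) x + 2 * radDerivQuot Ω x) := by
      funext x; rw [hdivW]; ring
    rw [e]
    exact hgL2.integrable_mul (hΔ.add (mq.const_mul 2))
  -- IBP2: `∫ Ω div(r²∇g) + ∫ ⟪r²∇g, ∇Ω⟫ = 0`
  have ibp2 := integral_mul_divergence_add_eq_zero_of_integrable (θ := Ω)
    (u := fun y => (cylRadius y ^ 2) • gradient g y) hΩ1 hV ?_ (m0.integrable_mul hdivg) ?_
  rotate_left
  · -- `Ω • (r²∇g) ∈ L¹`
    have hb : Integrable fun x => |Ω x| *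
        (|cylRadius x ^ 2 * fderiv ℝ g x (EuclideanSpace.single 0 1)| +
          |cylRadius x ^ 2 * fderiv ℝ g x (EuclideanSpace.single 1 1)| +
          |cylRadius x ^ 2 * fderiv ℝ g x (EuclideanSpace.single 2 1)|) := by
      have := ((m0.norm.integrable_mul (hDg 0).norm).add (m0.norm.integrable_mul (hDg 1).norm)).add
        (m0.norm.integrable_mul (hDg 2).norm)
      refine this.congr (Eventually.of_forall fun x => ?_)
      simp only [Pi.add_apply, Pi.mul_apply, Real.norm_eq_abs]
      ring
    refine hb.mono' ((hΩ1.continuous.smul hV.continuous).aestronglyMeasurable)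
      (Eventually.of_forall fun x => ?_)
    rw [norm_smul, Real.norm_eq_abs]
    gcongr
    rw [norm_smul, Real.norm_eq_abs]
    calc |cylRadius x ^ 2| * ‖gradient g x‖
        ≤ |cylRadius x ^ 2| * (|gradient g x 0| + |gradient g x 1| + |gradient g x 2|) := by
          gcongr; exact norm_le_abs_add _
      _ = _ := by simp only [gradient_apply_eq_fderiv_single₃, abs_mul]; ring
  · simp_rw [hpair']; exact ipair
  -- assemble the diffusion term
  have hD' : ∫ x, φ x * ((Δ Ω) x + 2 * radDerivQuot Ω x) =
      ∫ x, Ω x * VectorCalculus.divergence (fun y => (cylRadius y ^ 2) • gradient g y) x := by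
    have e1 : ∫ x, φ x * ((Δ Ω) x + 2 * radDerivQuot Ω x) =
        ∫ x, g x * VectorCalculus.divergence (fun y => (cylRadius y ^ 2) • gradient Ω y) x :=
      integral_congr_ae (Eventually.of_forall fun x => by simp only [hφdef]; rw [hdivW]; ring)
    have e2 : ∫ x, ⟪(cylRadius x ^ 2) • gradient g x, gradient Ω x⟫ =
        ∫ x, ⟪(cylRadius x ^ 2) • gradient Ω x, gradient g x⟫ :=
      integral_congr_ae (Eventually.of_forall fun x => hpair' x)
    rw [e1]
    linarith
  -- integrate the equation against `φ`
  have iΔ : Integrable fun x => φ x * ((Δ Ω) x + 2 * radDerivQuot Ω x) :=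
    hgL2.integrable_mul (hΔ.add (mq.const_mul 2))
  have iTr : Integrable fun x => φ x * fderiv ℝ Ω x (v t x) := by
    -- `DΩ[v] = Σⱼ vⱼ ∂ⱼΩ`, `v` bounded
    have e : (fun x => φ x * fderiv ℝ Ω x (v t x)) = fun x =>
        v t x 0 * (φ x * fderiv ℝ Ω x (EuclideanSpace.single 0 1)) +
        v t x 1 * (φ x * fderiv ℝ Ω x (EuclideanSpace.single 1 1)) +
        v t x 2 * (φ x * fderiv ℝ Ω x (EuclideanSpace.single 2 1)) := by
      funext x
      conv_lhs => rw [eq_add_smul_single₃ (v t x)]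
      rw [map_add, map_add, map_smul, map_smul, map_smul, smul_eq_mul, smul_eq_mul, smul_eq_mul]
      ring
    rw [e]
    have hbd : ∀ j : Fin 3, Integrable fun x => v t x j * (φ x * fderiv ℝ Ω x (EuclideanSpace.single j 1)) :=
      fun j => (hgL2.integrable_mul (m1 j)).bdd_mul
        ((contDiff_apply_coord_vec3 hv1 j).continuous.aestronglyMeasurable)
        (Eventually.of_forall fun x => ((Real.norm_eq_abs _).le.trans
          ((Real.norm_eq_abs _).symm.le.trans (PiLp.norm_apply_le (v t x) j))).trans (hB t ht x))
    exact ((hbd 0).add (hbd 1)).add (hbd 2)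
  calc ∫ x, φ x * Ω' x
      = ∫ x, (ν * (φ x * ((Δ Ω) x + 2 * radDerivQuot Ω x)) - φ x * fderiv ℝ Ω x (v t x)) :=
        integral_congr_ae (Eventually.of_forall fun x => by
          show φ x * Ω' x = ν * (φ x * ((Δ Ω) x + 2 * radDerivQuot Ω x)) - φ x * fderiv ℝ Ω x (v t x)
          rw [heq x]; ring)
    _ = ν * (∫ x, φ x * ((Δ Ω) x + 2 * radDerivQuot Ω x)) - ∫ x, φ x * fderiv ℝ Ω x (v t x) := by
        rw [integral_sub (iΔ.const_mul ν) iTr, integral_const_mul]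
    _ = _ := by rw [hD', hT']; ring

end Slice


end Literature.Analysis.FluidPDE

end
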